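import Literature.Geometry.Lorentzian.SoundNearKerrLeaf
import HarnessLib

/-!
# PINNED sound near-Kerr leaves — the hypothesis-side repair found by the line
# `direct-method-on-the-cone` (crux `BondiBartnikRigidity`, stmt-FinalStateConjecture-10807, lead a2)

Third revision of the repaired leaf predicate of routes `BartnikGapSettling` / `QuietWindowCapture`
(first: `IsHonestNearKerrLeaf`; second: `CauchyDevelopment.IsSoundNearKerrLeaf`,
`Literature/Geometry/Lorentzian/SoundNearKerrLeaf.lean`, p125168): `IsPinnedSoundNearKerrLeaf 𝒟 k ε N M a S`
is the block of `IsSoundNearKerrLeaf` VERBATIM (typed block + (S₁) `2Mᵢ ≤ Rᵢ` + (S₂)/(S₃) layer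
certification + (S₄) flat-frame tube separation + (S₅) achronal flat sheet) followed by

* (S₆) TIP PINNING: `∀ i, ‖(mo i).2 − e₀‖ ≤ Rᵢ + 1` — the Kerr–Schild origin event of each hole (a
  point of its slab `{t*ᵢ = 0}`, in the common flat coordinates) lies within `Rᵢ + 1` of the tip
  `(1, 0̲)` of the flat chart's unit hyperboloid.

Why (wave 1 of lead a2, worker K3, report attached to the crux item as `K3-report-a2.md`, §2): without
(S₆) a hole that is small on the unit scale may sit at flat distance `L → ∞` from the tip, where the
(η-achronal, hence `g`-achronal) sheet is null to `O(L⁻²)` across the hole's whole neighbourhood; along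
such hypothesis leaves, near-minimising instances of the crux admit focused incoming trains of total
energy `≤ γ` spoiling every `(ε₁, k₁)`-Kerr box in `J⁺(C)` up to collar time `≍ L^{q/(1−q)} → ∞` at
fixed `(k', Λ, δ, γ)`, so that no argument on compacta of uniformly bounded size — in particular not
the direct method's compactness step K3 — can use the typed or the unpinned sound hypothesis leaf.
With (S₆) (TRIAGE-r2-2 item (ii): "pin the flat chart to `p`") the quiet window is uniform.  No boost
clause is needed: a hole disc of radius `Rᵢ ≥ 2Mᵢ` boosted with `γv` must fit in the flat layer of
time-thickness `2` by the overlap clause, so `γv ≲ 1/Rᵢ ≤ 1/(2Mᵢ)`.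

The lead's reshaped skeleton types the genuine `N = 1` stubs K3/K4 over this predicate (plus a
rest-frame collar chart, `(mo' 0).1 = 1`, the frame normalisation asked for by worker K4) and routes
the complement into the flagged filed-text residue; the planner's restatement of the crux should adopt
both on the HYPOTHESIS side (and may then promote this predicate to
`Literature/Geometry/Lorentzian/`, as happened with the second revision).  Also here: the projections
`.isSoundNearKerrLeaf`, `.isNearKerrLeaf`, monotonicity `.mono`, and the registered bookkeeping
sub-goal `stub_pinnedSoundLeafIsTyped` (pinned sound leaves of a vacuum Cauchy development are typed
leaves), under which this vocabulary file serves the crux item.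

References: DHRT arXiv:2104.08222, §1 (chart/deviation vocabulary); O'Neill 1983, Ch. 14, p. 413
(achronal sets). [DafermosHolzegelRodnianskiTaylor2021] [ONeillSemiRiemannian1983]
-/

noncomputable section

-- D-0017: single-problem summit, `Summit.<S>.<S>.…` by design (cf. lakefile `weak.linter.dupNamespace`).
set_option linter.dupNamespace false

open Set Filter Function Topology TopologicalSpace
open Literature.Geometry.Lorentzian
open scoped Manifold ContDiff Topology ENNReal

namespace Summit.FinalStateConjecture.FinalStateConjecture.Theorems.BondiBartnikRigidity.DirectMethod

/-! ## The pinned sound leaf predicate (report §2: the hypothesis-side repair K3 needs) -/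

section PinnedSound

universe u

variable {X : Type u} [TopologicalSpace X] [ChartedSpace E3 X] [IsManifold (𝓡 3) ∞ X]
  [ConnectedSpace X] {D : InitialDataSet (𝓡 3) X}

/-- **`S` is a PINNED SOUND `(ε, k)`-near-Kerr leaf** of `𝒟` with `N` holes: the block of
`CauchyDevelopment.IsSoundNearKerrLeaf` VERBATIM (typed block + (S₁) `2Mᵢ ≤ Rᵢ`, (S₂)/(S₃) LAYER
certification of the hole and flat charts, (S₄) flat-frame tube separation, (S₅) achronal flat sheet),
followed by (S₆) TIP PINNING: the Kerr–Schild origin event `cᵢ = (mo i).2` of each hole (a point of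
its slab `{t*ᵢ = 0}`, in the common flat coordinates) lies within Euclidean distance `Rᵢ + 1` of the
tip `(1, 0, 0, 0)` of the unit hyperboloid `{x⁰ = √(1 + |x̲|²)}` of the flat chart.  Without (S₆) a
hole that is small on the unit scale may sit at flat distance `L → ∞` from the tip, where the sheet is
null to `O(L⁻²)` across the hole's whole neighbourhood (triage r2-2 (s1)); report §2 shows that along
such hypothesis leaves near-minimising instances admit focused incoming trains of total energy `≤ γ`
spoiling every Kerr box up to collar time `≍ L^{q/(1−q)}`, so that no argument on compacta of
uniformly bounded size — in particular not the line's direct method — can produce K3's box; (S₆) (or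
the tolerance-scaled flat background of triage r2-2 (E4)(b)) is the hypothesis-side restatement the
line needs.  Chart/deviation vocabulary: DHRT arXiv:2104.08222, §1; achronal sets: O'Neill 1983,
Ch. 14, p. 413.  Route-posited notion (third revision of the repaired leaf predicate), nothing is
asserted about it. [cite: DafermosHolzegelRodnianskiTaylor2021, §1] -/
def IsPinnedSoundNearKerrLeaf (𝒟 : CauchyDevelopment D) (k : ℕ) (ε : ℝ≥0∞) (N : ℕ)
    (M a : Fin N → ℝ) (S : Set 𝒟.carrier) : Prop :=
  ∃ (R ρ : Fin N → ℝ) (mo : Fin N → lorentzGroup × E4) (r : Fin N → E4 → ℝ)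
    (B : Fin N → ModelBackground) (U₀ : Opens E4) (B₀ : ModelBackground)
    (Ψ : ∀ i, (B i).domain → 𝒟.carrier) (Ψ₀ : B₀.domain → 𝒟.carrier)
    (L W : ∀ i, Set (B i).domain) (L₀ W₀ : Set B₀.domain),
    (∀ i, r i = fun x => Kerr.radius (a i) (poincareInv (mo i).1 (mo i).2 x)) ∧
    (∀ i, B i = starBackground (mo i).1 (mo i).2 (M i) (a i) (r i)) ∧
    B₀ = hypBackground U₀ ∧
    (∀ i, L i = {x | -1 < (B i).time x.1 ∧ (B i).time x.1 < 1 ∧ (B i).radius x.1 < R i + 1} ∧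
      W i = {x | 0 < (B i).time x.1 ∧ (B i).time x.1 < 1 ∧ (B i).radius x.1 ≤ R i}) ∧
    L₀ = {x | -1 < B₀.time x.1 ∧ B₀.time x.1 < 1} ∧
    W₀ = {x | 0 < B₀.time x.1 ∧ B₀.time x.1 < 1} ∧
    (∀ i, 0 < M i ∧ |a i| ≤ M i ∧ 0 < ρ i ∧ ρ i < R i) ∧
    {x : E4 | -1 < x 0 - Real.sqrt (1 + E4.spatialNorm x ^ 2) ∧ ∀ i, ρ i < r i x} ⊆
      (U₀ : Set E4) ∧
    (∀ i, ContMDiffOn 𝓘(ℝ, E4) (𝓡 4) ∞ (Ψ i) (L i) ∧ IsOpenEmbedding ((L i).restrict (Ψ i)) ∧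
      Ψ i '' L i ⊆ 𝒟.metric.causalFuture 𝒟.timeOrientation (range 𝒟.embed)) ∧
    ContMDiffOn 𝓘(ℝ, E4) (𝓡 4) ∞ Ψ₀ L₀ ∧ IsOpenEmbedding (L₀.restrict Ψ₀) ∧
    Ψ₀ '' L₀ ⊆ 𝒟.metric.causalFuture 𝒟.timeOrientation (range 𝒟.embed) ∧
    (∀ i, 𝒟.toSpacetime.truncDeviationCk (B i) (Ψ i) k (R i) 0 ≤ ε) ∧
    𝒟.toSpacetime.deviationCk B₀ Ψ₀ k 0 ≤ ε ∧
    Pairwise (Function.onFun Disjoint fun i => Ψ i '' {x | x ∈ L i ∧ (B i).radius x.1 ≤ R i}) ∧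
    (∀ i, Ψ i '' {x | (B i).time x.1 = 0 ∧ ρ i < (B i).radius x.1 ∧ (B i).radius x.1 ≤ R i} ⊆
      Ψ₀ '' L₀) ∧
    (∀ i, Ψ₀ '' {x | B₀.time x.1 = 0 ∧ ρ i < r i x.1 ∧ r i x.1 < R i} ⊆ Ψ i '' L i) ∧
    S = Ψ₀ '' B₀.timeSlab 0 ∪ ⋃ i, Ψ i '' (B i).truncTimeSlab (R i) 0 ∧
    Ψ₀ '' W₀ ∪ ⋃ i, Ψ i '' W i ⊆ 𝒟.metric.chronologicalFuture 𝒟.timeOrientation S ∧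
    𝒟.exteriorOf (Ψ₀ '' W₀ ∪ ⋃ i, Ψ i '' W i) \ (Ψ₀ '' W₀ ∪ ⋃ i, Ψ i '' W i) ⊆
      𝒟.metric.causalPast 𝒟.timeOrientation S ∧
    -- (S₁) thick honest discs
    (∀ i, 2 * M i ≤ R i) ∧
    -- (S₂) near-zone LAYER certification of the hole charts
    (∀ i, supCkENorm (Subtype.val '' {x : (B i).domain | x ∈ L i ∧ (B i).radius x.1 ≤ R i}) k
      (𝒟.toSpacetime.deviationExtend (B i) (Ψ i)) ≤ ε) ∧
    -- (S₃) LAYER certification of the flat chart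
    supCkENorm (Subtype.val '' L₀) k (𝒟.toSpacetime.deviationExtend B₀ Ψ₀) ≤ ε ∧
    -- (S₄) flat-frame tube separation
    Pairwise (Function.onFun Disjoint fun i =>
      {x : E4 | -1 < x 0 - Real.sqrt (1 + E4.spatialNorm x ^ 2) ∧
        x 0 - Real.sqrt (1 + E4.spatialNorm x ^ 2) < 1 ∧ r i x ≤ R i}) ∧
    -- (S₅) achronal flat sheet
    𝒟.metric.IsAchronal 𝒟.timeOrientation (Ψ₀ '' B₀.timeSlab 0) ∧
    -- (S₆) TIP PINNING: the hole centres lie within `Rᵢ + 1` of the hyperboloid's tip `(1, 0̲)`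
    (∀ i, ‖(mo i).2 - EuclideanSpace.single (0 : Fin 4) (1 : ℝ)‖ ≤ R i + 1)

namespace IsPinnedSoundNearKerrLeaf

variable {𝒟 : CauchyDevelopment D} {k k' : ℕ} {ε ε' : ℝ≥0∞} {N : ℕ} {M a : Fin N → ℝ}
  {S : Set 𝒟.carrier}

/-- Pinned sound leaves are sound leaves (drop (S₆); same charts).
[cite: DafermosHolzegelRodnianskiTaylor2021, §1] -/
theorem isSoundNearKerrLeaf (h : IsPinnedSoundNearKerrLeaf 𝒟 k ε N M a S) :
    𝒟.IsSoundNearKerrLeaf k ε N M a S := by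
  obtain ⟨R, ρ, mo, r, B, U₀, B₀, Ψ, Ψ₀, L, W, L₀, W₀, h1, h2, h3, h4, h5, h6, h7, h8, h9, h10, h11,
    h12, h13, h14, h15, h16, h17, h18, h19, h20, h21, h22, h23, h24, h25, -⟩ := h
  exact ⟨R, ρ, mo, r, B, U₀, B₀, Ψ, Ψ₀, L, W, L₀, W₀, h1, h2, h3, h4, h5, h6, h7, h8, h9, h10, h11,
    h12, h13, h14, h15, h16, h17, h18, h19, h20, h21, h22, h23, h24, h25⟩

/-- Pinned sound leaves are typed leaves (the hypothesis the registered K3 consumes).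
[cite: DafermosHolzegelRodnianskiTaylor2021, §1] -/
theorem isNearKerrLeaf (h : IsPinnedSoundNearKerrLeaf 𝒟 k ε N M a S) :
    𝒟.IsNearKerrLeaf k ε N M a S :=
  h.isSoundNearKerrLeaf.isNearKerrLeaf

/-- **Monotonicity in `(k, ε)`** of the pinned sound predicate (as for `IsSoundNearKerrLeaf.mono`,
(S₆) does not mention `(k, ε)`). [cite: DafermosHolzegelRodnianskiTaylor2021, §1] -/
theorem mono (h : IsPinnedSoundNearKerrLeaf 𝒟 k' ε N M a S) (hk : k ≤ k') (hε : ε ≤ ε') :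
    IsPinnedSoundNearKerrLeaf 𝒟 k ε' N M a S := by
  obtain ⟨R, ρ, mo, r, B, U₀, B₀, Ψ, Ψ₀, L, W, L₀, W₀, hr, hB, hB₀, hLW, hL₀, hW₀, hpar, hU₀, hΨ,
    hΨ₀, hΨ₀e, hΨ₀J, hdev, hdev₀, h15, h16, h17, h18, h19, h20, hS1, hS2, hS3, hS4, hS5, hS6⟩ := h
  exact ⟨R, ρ, mo, r, B, U₀, B₀, Ψ, Ψ₀, L, W, L₀, W₀, hr, hB, hB₀, hLW, hL₀, hW₀, hpar, hU₀, hΨ,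
    hΨ₀, hΨ₀e, hΨ₀J, fun i ↦ ((supCkENorm_mono_right _ hk _).trans (hdev i)).trans hε,
    ((supCkENorm_mono_right _ hk _).trans hdev₀).trans hε, h15, h16, h17, h18, h19, h20, hS1,
    fun i ↦ ((supCkENorm_mono_right _ hk _).trans (hS2 i)).trans hε,
    ((supCkENorm_mono_right _ hk _).trans hS3).trans hε, hS4, hS5, hS6⟩

end IsPinnedSoundNearKerrLeaf

end PinnedSound

/-- **Registered bookkeeping sub-goal of the line** (`stub_pinnedSoundLeafIsTyped`): in the summit's
universe-`0` setting, a pinned sound leaf of a vacuum Cauchy development is a typed leaf with the same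
labels and the same set (projection through `IsSoundNearKerrLeaf.isNearKerrLeaf`) — the step by which
the reshaped composition feeds the conclusion of the crux. [cite: DafermosHolzegelRodnianskiTaylor2021, §1] -/
theorem stub_pinnedSoundLeafIsTyped : ∀ (X : Type) [TopologicalSpace X] [ChartedSpace E3 X] [IsManifold (𝓡 3) ∞ X] [T2Space X] [SecondCountableTopology X] [ConnectedSpace X] (D : InitialDataSet (𝓡 3) X) (𝒟 : VacuumCauchyDevelopment D) (k : ℕ) (ε : ℝ≥0∞) (N : ℕ) (M a : Fin N → ℝ) (S : Set 𝒟.carrier), IsPinnedSoundNearKerrLeaf 𝒟.toCauchyDevelopment k ε N M a S → 𝒟.toCauchyDevelopment.IsNearKerrLeaf k ε N M a S :=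
  fun _ _ _ _ _ _ _ _ _ _ _ _ _ _ _ h ↦ h.isNearKerrLeaf

end Summit.FinalStateConjecture.FinalStateConjecture.Theorems.BondiBartnikRigidity.DirectMethod

end
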